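import Literature.AnabelianGeometry.EtaleTheta.Discharge.Sec3Thm37ivGenuineBase
import Literature.AnabelianGeometry.EtaleTheta.RealifiedDivisorMonoidsOfRlfWeak
import Literature.AlgebraicGeometry.Frobenioids.RealificationMonoidOn
import Literature.AlgebraicGeometry.Frobenioids.RlfStructureWeak
import HarnessLib

/-!
# [EtTh] Def 3.6 (i), `Λ = ℝ` over the WEAK vocabulary: `Φ₀(g)^rlf` injective for divisibility-reflecting `Φ₀(g)`,
# and the binder `hBinj` at the non-vacuous constructed data `ofRlfRWeak` from two Def 3.3 (iii)-level clauses

S. Mochizuki, *The étale theta function and its Frobenioid-theoretic manifestations*, Publ. RIMS **45** (2009)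
[MochizukiEtTh2009], Def. 3.3 (iii) PDF p. 73, Def. 3.6 (i) p. 76 ("`Φ₀^ℝ := Φ₀^rlf`"; "`B₀^Λ` for … `ℝ·Φ₀^birat`
if `Λ = ℝ`") [cite: MochizukiEtTh2009, Def 3.6 p.76], Lemma 3.5 p. 75–76 (the extension `P^rlf → Q` of an
order-embedding with group-saturated image reflects `≤`) [cite: MochizukiEtTh2009, Lem 3.5 p.76]; S. Mochizuki,
*The geometry of Frobenioids I* (2008), Def. 2.4 (i) p. 48 (`M^rlf`), Prop. 5.3 p. 103 ("the divisor monoid `Φ^rlf`",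
"the rational function monoid `ℝ·Φ^birat`") [cite: MochizukiFrdI2008, Prop. 5.3 p.103].

abc-iut cell, block C / W6, seat abc-iut-w6-d048 (gen 3).  PROOF-ONLY (0 definitions, 0 `Prop` facts, 0 instances).
WEAK-VOCABULARY TWIN of `Sec3BLambdaInjectiveOfRlfRReflects.lean` (same seat).  Cell finding F-L2d2-1: at tempered
coverings with infinitely many special-fibre components (`Ÿ`, `Z_∞` — the objects of §§4–5) the printed hypothesis
"`Φ₀(Y)` perf-factorial" of the STRONG constructor `ofRlfR dm hpf` is unsatisfiable, so the Def. 3.6 (i) data the cell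
actually uses are abc-iut-L6-t12's `ofRlfZWeak` / `ofRlfRWeak dm hpf` over `treeMonoidVocabWeak`
(`hpf : ∀ Y, IsPerfFactorialCof (Φ₀ Y)`: weakly perf-factorial with cofinal perfection, Mochizuki's own sentence in
the proof of Lemma 3.5).  For those data neither abc-iut-w5-d153's `Sec3BLambdaInjectiveOfRlfR.lean` nor the strong
twin says anything.  This file:

* §1 **`rlfMapWeak_injective_of_reflects`** — [FrdI] row P53/L02a's monoid-theoretic core over the WEAK vocabulary:
  for `Φ(f) : Φ(j) → Φ(j')` injective and REFLECTING divisibility (weakly perf-factorial values with cofinal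
  perfection), the realified map `Φ(f)^rlf = rlfMapWeak Φ hΦ f` is injective — the image of `Φ(j)^pf → Φ(j')^pf →
  Φ(j')^rlf` is group-saturated (`RlfCoordWeak.toRealification_dvd_iff`, `Perfection.dvd_of_map_dvd_of_reflects`), so
  the order-reflection clause of [EtTh] Lemma 3.5 (abc-iut-L2-d2's `RlfUniversalWeak.lift_injective`) applies to
  the unique extension.  Verbatim the argument of abc-iut-w5-d137 / abc-iut-L1-d2's strong
  `IsPerfFactorial.Rlf.map_injective_of_reflects` (`RealificationMonoidOn.lean`), with the weak names.
* §2 at `ofRlfRWeak dm hpf`: `ofRlfRWeak_ΦR_map_injective_of_reflects`; `ofRlfRWeak_hBinj_of_rlfMapWeak_injective`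
  (`B₀^ℝ(g)` is the restriction of `(Φ₀(g)^rlf)^gp` to `ℝ·Φ₀^birat`; groupification preserves injectivity between
  cancellative monoids — the weak form of abc-iut-w5-d153's `ofRlfR_hBinj_of_rlfMap_injective`);
  **`ofRlfRWeak_hBinj_of_reflects (hΦinj : ∀ g, Injective (dm.Φ₀.map g).hom) (hΦrefl : ∀ g a b, Φ₀(g) a ∣ Φ₀(g) b → a ∣ b)`**;
  `ofRlfRWeak_hBinj_of_isMonoidOn_of_reflects`.
* §3 consumers (any category vocabulary `treeCatVocab`): "`B` is a monoid on `D`" and "`C` IS a Frobenioid" (Def. 3.6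
  (ii), last sentence) for EVERY tempered Frobenioid of monoid type `ℝ` over `ofRlfRWeak dm hpf`, over a base of
  FSM-type resp. over print's GENUINE base `ConnectedPart (BTemp Π)`, from `hΦinj`, `hΦrefl` — NO Def-3.6-level binder.
Both clauses hold for print's `Φ₀` (inclusions of invariants `Div⁺(Z_∞)^{Gal(Z_∞/Y)} ⊆ Div⁺(Z_∞)^{Gal(Z_∞/Y')}`;
`b − a` effective and `Gal(Z_∞/Y)`-invariant when `a`, `b` are); `hΦinj` is a THEOREM at abc-iut-w6-d058's constructed
connected data (`DivisorMonoids.ofGaloisActionConnected_Φ₀_map_injective`).  Binder census at `Λ = ℝ`, weak data: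
{`hBinj`} ↦ {`hΦinj`, `hΦrefl`}.  HONEST FRAMING: refereed pre-IUT material; reductions between explicit hypotheses on
abstract data; nothing here bears on [IUTchIII] Cor. 3.12; typed ≠ proved.
-/

namespace Literature.AnabelianGeometry.EtaleTheta

open CategoryTheory Opposite Function Literature.AlgebraicGeometry.Frobenioids
  Literature.AnabelianGeometry.SemiGraphs

universe u₀ v₀ u v w

/-! ### §1 [FrdI] P53/L02a over the weak vocabulary: `Φ(f)^rlf` injective for divisibility-reflecting `Φ(f)` -/

section RlfMapWeak

variable {J : Type u} [Category.{v} J] (Φ : J ⥤ CommMonCat.{w}) (hΦ : ∀ j : J, IsPerfFactorialCof (Φ.obj j))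

/-- `Φ(j)^pf → Φ(j)^rlf` is injective over the weak vocabulary (the factorization homomorphism is, [FrdI]
Def. 2.4 (i)(c)). [cite: MochizukiFrdI2008, Def. 2.4 (i) p.48] -/
theorem toRealification_injective_weak (j : J) : Injective (hΦ j).weak.toRealification := fun _ _ h =>
  (hΦ j).weak.factorMap_injective (congrArg Subtype.val h)

/-- **`Φ(f)^rlf` is injective for an injective, divisibility-REFLECTING `Φ(f)`** (weakly perf-factorial values with
cofinal perfection): the image of `Φ(j)^pf → Φ(j')^pf → Φ(j')^rlf` is group-saturated, so the extension
`Φ(f)^rlf` reflects `≤` ([EtTh] Lemma 3.5, `RlfUniversalWeak.lift_injective`).  Weak twin of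
`IsPerfFactorial.Rlf.map_injective_of_reflects` ([FrdI] row P53/L02a; false for merely characteristically injective
`Φ(f)`, finding P53-F1). [cite: MochizukiFrdI2008, Prop. 5.3 p.103] -/
theorem rlfMapWeak_injective_of_reflects {j j' : J} (f : j ⟶ j') (hinj : Injective (Φ.map f).hom)
    (hrefl : ∀ a b : Φ.obj j, (Φ.map f).hom a ∣ (Φ.map f).hom b → a ∣ b) :
    Injective (rlfMapWeak Φ hΦ f) := by
  refine RlfUniversalWeak.lift_injective (hΦ j).weak (hΦ j).rlfCofinal
    ((hΦ j').weak.toRealification.comp (Perfection.map (Φ.map f).hom)) ?_ ?_ (rlfMapWeak Φ hΦ f)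
    (rlfMapWeak_comp_toRealification Φ hΦ f)
  · exact (toRealification_injective_weak Φ hΦ j').comp (perfectionMap_injective (Φ.map f).hom hinj)
  · rw [isGroupSaturated_iff']
    rintro q _ ⟨a, rfl⟩ _ ⟨b, rfl⟩ hq
    have hdvd : (hΦ j').weak.toRealification (Perfection.map (Φ.map f).hom b) ∣
        (hΦ j').weak.toRealification (Perfection.map (Φ.map f).hom a) :=
      ⟨q, by rw [MonoidHom.comp_apply, MonoidHom.comp_apply] at hq; rw [← hq, mul_comm]⟩
    rw [RlfCoordWeak.toRealification_dvd_iff (hΦ j').weak (RlfCoordWeak.isMonoprime_pfAt (hΦ j').weak)] at hdvd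
    obtain ⟨c, hc⟩ := Perfection.dvd_of_map_dvd_of_reflects (Φ.map f).hom hrefl hdvd
    refine ⟨c, ?_⟩
    haveI : IsCancelMul (hΦ j').weak.Rlf := IsPerfFactorialWeak.Rlf.isCancelMul (hΦ j').weak
    apply mul_right_cancel (b := ((hΦ j').weak.toRealification.comp (Perfection.map (Φ.map f).hom)) b)
    rw [hq, hc, map_mul, mul_comm]

end RlfMapWeak

/-! ### §2 `hBinj` at `ofRlfRWeak` -/

namespace RealifiedDivisorMonoids

variable {D₀ : Type u₀} [Category.{v₀} D₀] (dm : DivisorMonoids.{u₀, v₀, w} D₀)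
  (hpf : ∀ Y : D₀ᵒᵖ, IsPerfFactorialCof (dm.Φ₀.obj Y))

/-- **`Φ₀^ℝ(g)` of `ofRlfRWeak` (= `Φ₀(g)^rlf`, weak) is injective** from `hΦinj`, `hΦrefl`.
[cite: MochizukiEtTh2009, Def 3.6 p.76] -/
theorem ofRlfRWeak_ΦR_map_injective_of_reflects
    (hΦinj : ∀ {Y Y' : D₀ᵒᵖ} (g : Y ⟶ Y'), Injective (dm.Φ₀.map g).hom)
    (hΦrefl : ∀ {Y Y' : D₀ᵒᵖ} (g : Y ⟶ Y') (a b : dm.Φ₀.obj Y),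
      (dm.Φ₀.map g).hom a ∣ (dm.Φ₀.map g).hom b → a ∣ b)
    {Y Y' : D₀ᵒᵖ} (g : Y ⟶ Y') : Injective ((ofRlfRWeak dm hpf).ΦR.map g).hom := by
  change Injective (rlfMapWeak dm.Φ₀ hpf g)
  exact rlfMapWeak_injective_of_reflects dm.Φ₀ hpf g (hΦinj g) (hΦrefl g)

/-- **`hBinj` at `ofRlfRWeak dm hpf` ⟸ the realified pull-backs `Φ₀(g)^rlf` are injective**: `B₀^ℝ(g)` is the
restriction of `(Φ₀(g)^rlf)^gp` to `ℝ·Φ₀^birat ⊆ (Φ₀^rlf)^gp`, and groupification preserves injectivity between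
cancellative monoids.  No `B₀`-level input (weak twin of abc-iut-w5-d153's `ofRlfR_hBinj_of_rlfMap_injective`).
[cite: MochizukiEtTh2009, Def 3.6 p.76] -/
theorem ofRlfRWeak_hBinj_of_rlfMapWeak_injective
    (hrlf : ∀ {Y Y' : D₀ᵒᵖ} (g : Y ⟶ Y'), Injective (rlfMapWeak dm.Φ₀ hpf g)) :
    ∀ {Y Y' : D₀ᵒᵖ} (g : Y ⟶ Y'), Injective ((ofRlfRWeak dm hpf).BΛ.map g).hom := by
  intro Y Y' g a b hab
  haveI : IsCancelMul ((realDataWeak dm hpf).rlf.obj (op (unop Y))) := IsPerfFactorialWeak.Rlf.isCancelMul (hpf Y).weak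
  haveI : IsCancelMul ((realDataWeak dm hpf).rlf.obj (op (unop Y'))) :=
    IsPerfFactorialWeak.Rlf.isCancelMul (hpf Y').weak
  have hg : Injective (pullGp (realDataWeak dm hpf).rlf g.unop) :=
    gpMap_injective (pull (realDataWeak dm hpf).rlf g.unop) (hrlf g)
  exact Subtype.ext (hg (congrArg Subtype.val hab))

/-- **`hBinj` at `ofRlfRWeak dm hpf` from `hΦinj`, `hΦrefl` alone** (`Λ = ℝ`, weak vocabulary): the pull-backs of
`B₀^ℝ = ℝ·Φ₀^birat` are injective as soon as the pull-backs of `Φ₀` are injective and reflect divisibility.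
[cite: MochizukiEtTh2009, Def 3.6 p.76] -/
theorem ofRlfRWeak_hBinj_of_reflects
    (hΦinj : ∀ {Y Y' : D₀ᵒᵖ} (g : Y ⟶ Y'), Injective (dm.Φ₀.map g).hom)
    (hΦrefl : ∀ {Y Y' : D₀ᵒᵖ} (g : Y ⟶ Y') (a b : dm.Φ₀.obj Y),
      (dm.Φ₀.map g).hom a ∣ (dm.Φ₀.map g).hom b → a ∣ b) :
    ∀ {Y Y' : D₀ᵒᵖ} (g : Y ⟶ Y'), Injective ((ofRlfRWeak dm hpf).BΛ.map g).hom :=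
  ofRlfRWeak_hBinj_of_rlfMapWeak_injective dm hpf fun g =>
    rlfMapWeak_injective_of_reflects dm.Φ₀ hpf g (hΦinj g) (hΦrefl g)

/-- The injectivity clause `hΦinj` is part of "`Φ₀` is a monoid on `D₀`" ([FrdI] Def. 1.1 (ii) (a)), so `hBinj` at
`ofRlfRWeak` also follows from Prop. 3.4 (i)'s "`Φ₀` defines a divisorial monoid on `D₀`" plus divisibility
reflection. [cite: MochizukiEtTh2009, Def 3.6 p.76] -/
theorem ofRlfRWeak_hBinj_of_isMonoidOn_of_reflects (hΦmon : IsMonoidOn dm.Φ₀)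
    (hΦrefl : ∀ {Y Y' : D₀ᵒᵖ} (g : Y ⟶ Y') (a b : dm.Φ₀.obj Y),
      (dm.Φ₀.map g).hom a ∣ (dm.Φ₀.map g).hom b → a ∣ b) :
    ∀ {Y Y' : D₀ᵒᵖ} (g : Y ⟶ Y'), Injective ((ofRlfRWeak dm hpf).BΛ.map g).hom :=
  ofRlfRWeak_hBinj_of_reflects dm hpf (fun g => (hΦmon.isCharInjective g.unop).1) hΦrefl

end RealifiedDivisorMonoids

/-! ### §3 The structural consumers over `ofRlfRWeak` -/

namespace TemperedFrobenioid

section FSMType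

variable {D₀ : Type u₀} [Category.{v₀} D₀] (dm : DivisorMonoids.{u₀, v₀, w} D₀)
  (hpf : ∀ Y : D₀ᵒᵖ, IsPerfFactorialCof (dm.Φ₀.obj Y)) {D : Type u} [Category.{v} D]
  {IsRational IsStrictlyRational : (Dᵒᵖ ⥤ CommMonCat.{w}) → Prop}

/-- **`hBmon` for monoid type `ℝ` (weak data) over a base of FSM-type**, from `hΦinj`, `hΦrefl`.
[cite: MochizukiEtTh2009, Def 3.6 p.77] -/
theorem isMonoidOn_ratFnFunctor_ofRlfRWeak_of_isOfFSMType
    (C₀ : TemperedFrobenioid (RealifiedDivisorMonoids.ofRlfRWeak dm hpf) D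
      (treeCatVocab D IsRational IsStrictlyRational))
    (hΦinj : ∀ {Y Y' : D₀ᵒᵖ} (g : Y ⟶ Y'), Injective (dm.Φ₀.map g).hom)
    (hΦrefl : ∀ {Y Y' : D₀ᵒᵖ} (g : Y ⟶ Y') (a b : dm.Φ₀.obj Y),
      (dm.Φ₀.map g).hom a ∣ (dm.Φ₀.map g).hom b → a ∣ b)
    (hD : IsOfFSMType D) : IsMonoidOn C₀.ratFnFunctor :=
  C₀.isMonoidOn_ratFnFunctor_of_isOfFSMType (RealifiedDivisorMonoids.ofRlfRWeak_hBinj_of_reflects dm hpf hΦinj hΦrefl) hD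

/-- **Def. 3.6 (ii), last sentence, at `Λ = ℝ` (weak data): a tempered Frobenioid over `ofRlfRWeak dm hpf` and a base
of FSM-type IS a Frobenioid**, from `hΦinj`, `hΦrefl`. [cite: MochizukiEtTh2009, Def 3.6 p.77] -/
theorem isFrobenioid_ofRlfRWeak_of_isOfFSMType
    (C₀ : TemperedFrobenioid (RealifiedDivisorMonoids.ofRlfRWeak dm hpf) D
      (treeCatVocab D IsRational IsStrictlyRational))
    (hΦinj : ∀ {Y Y' : D₀ᵒᵖ} (g : Y ⟶ Y'), Injective (dm.Φ₀.map g).hom)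
    (hΦrefl : ∀ {Y Y' : D₀ᵒᵖ} (g : Y ⟶ Y') (a b : dm.Φ₀.obj Y),
      (dm.Φ₀.map g).hom a ∣ (dm.Φ₀.map g).hom b → a ∣ b)
    (hD : IsOfFSMType D) : PreFrobenioid.IsFrobenioid C₀.toElem :=
  C₀.isFrobenioid_of_isOfFSMType (RealifiedDivisorMonoids.ofRlfRWeak_hBinj_of_reflects dm hpf hΦinj hΦrefl) hD

end FSMType

section ConnectedTemperoid

variable {G : Type u} [Group G] [TopologicalSpace G] {D₀ : Type u₀} [Category.{v₀} D₀]
  (dm : DivisorMonoids.{u₀, v₀, w} D₀) (hpf : ∀ Y : D₀ᵒᵖ, IsPerfFactorialCof (dm.Φ₀.obj Y))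
  {IsRational IsStrictlyRational : ((ConnectedPart (BTemp G))ᵒᵖ ⥤ CommMonCat.{w}) → Prop}

/-- **`hBmon` for monoid type `ℝ` (weak data) at print's GENUINE base `D = B^temp(Π)⁰`** (any topological group
`Π`), from `hΦinj`, `hΦrefl`. [cite: MochizukiEtTh2009, Def 3.6 p.77] -/
theorem isMonoidOn_ratFnFunctor_ofRlfRWeak_connectedPart_bTemp
    (C₀ : TemperedFrobenioid (RealifiedDivisorMonoids.ofRlfRWeak dm hpf) (ConnectedPart (BTemp G))
      (treeCatVocab (ConnectedPart (BTemp G)) IsRational IsStrictlyRational))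
    (hΦinj : ∀ {Y Y' : D₀ᵒᵖ} (g : Y ⟶ Y'), Injective (dm.Φ₀.map g).hom)
    (hΦrefl : ∀ {Y Y' : D₀ᵒᵖ} (g : Y ⟶ Y') (a b : dm.Φ₀.obj Y),
      (dm.Φ₀.map g).hom a ∣ (dm.Φ₀.map g).hom b → a ∣ b) :
    IsMonoidOn C₀.ratFnFunctor :=
  C₀.isMonoidOn_ratFnFunctor_connectedPart_bTemp
    (RealifiedDivisorMonoids.ofRlfRWeak_hBinj_of_reflects dm hpf hΦinj hΦrefl)

/-- **A tempered Frobenioid of monoid type `ℝ` over the non-vacuous constructed data `ofRlfRWeak` and the genuine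
base `B^temp(Π)⁰` IS a Frobenioid** — NO Def-3.6-level binder: only `hΦinj`, `hΦrefl`.
[cite: MochizukiEtTh2009, Def 3.6 p.77] -/
theorem isFrobenioid_ofRlfRWeak_connectedPart_bTemp
    (C₀ : TemperedFrobenioid (RealifiedDivisorMonoids.ofRlfRWeak dm hpf) (ConnectedPart (BTemp G))
      (treeCatVocab (ConnectedPart (BTemp G)) IsRational IsStrictlyRational))
    (hΦinj : ∀ {Y Y' : D₀ᵒᵖ} (g : Y ⟶ Y'), Injective (dm.Φ₀.map g).hom)
    (hΦrefl : ∀ {Y Y' : D₀ᵒᵖ} (g : Y ⟶ Y') (a b : dm.Φ₀.obj Y),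
      (dm.Φ₀.map g).hom a ∣ (dm.Φ₀.map g).hom b → a ∣ b) :
    PreFrobenioid.IsFrobenioid C₀.toElem :=
  C₀.isFrobenioid_connectedPart_bTemp (RealifiedDivisorMonoids.ofRlfRWeak_hBinj_of_reflects dm hpf hΦinj hΦrefl)

end ConnectedTemperoid

end TemperedFrobenioid

end Literature.AnabelianGeometry.EtaleTheta
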